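import Summits.HodgeConjecture.HodgeConjecture.Theorems.F0P3cStCharTSXIGData      -- ★ p850103 (LH6-p03): the flipped base `b′`; brings ★ `coe_localNonsplitEquiv_eq_map`, ★ `diagonal_three_pow`, the XIG′ tokens
import HarnessLib

/-!
# F0 · P3c · line LH6 «StCharTS» — road (D), «B-DIAG★»: the UNFLIPPED base `b = z · aᵐ` of the deep shell is the diagonal `d(βαᵐ, β, β(σ_w α)⁻ᵐ)` at `w`, with
# `|βαᵐ|_w < |β|_w < |β(σ_w α)⁻ᵐ|_w` — the inputs `hdb ∕ hb01 ∕ hb12` of ★ p850178 `hOG_indicator_shell` (and of ★ p850100) for the XIG-ASSEMBLY head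

Cell `pub/hodgecm-mathlib`, crux H413 = `stmt-HodgeConjecture-24833` (lane `--supports … --as helper`), route HCCMUnconditional; seat A-p16 (g34), «HEAD-DRAFT-A» co-pilot of the
road (D) owner LH6-p04 (g3) (integration note (i) 2026-09-02T07:36Z).  THEOREMS ONLY (no definition, no instance, no notation, no named fact, no `sorry`); ★-only imports.
HONEST LABEL: HC_CM is proved only modulo the 7 printed citations (2 remaining: hLiu418 = stmt-HodgeConjecture-24832, h413 = stmt-HodgeConjecture-24833) until rung 0 closes;
count-neutral plumbing of road (D).

THE MATHEMATICS.  `G = U(Φ₃)(L⁺_v)`, `v` non-split (`w ∣ v`, `c • w = w`), one-place model `E₃ = localNonsplitEquiv` (its matrix is the `w`-component of the matrix over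
`LocalRing L v = ∏_{w′∣v} L_{w′}`, ★ `coe_localNonsplitEquiv_eq_map`, definitional).  For `z` central with `E₃ z = β·1` and the ray `a` with `E₃ a = d(α, 1, (σ_w α)⁻¹)`,
`0 < |α|_w < 1`, `|β|_w = 1`: the torus element `b = z aᵐ ∈ T₃` is `glDiagonal 3 _ db` for units `db` of the product ring (★ `mem_torusU_iff`), and at `w` its entries are
`βαᵐ, β, β(σ_w α)⁻ᵐ` (the computation inside ★ `F0P3cStCharTSXIGData.exists_flipBase`, before the flip), so `|db 0|_w < |db 1|_w < |db 2|_w` for `m ≥ 1` (`|σ_w α|_w = |α|_w`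
★ `valued_galAdicCompletionMap`).  This is the `(hdb, hb01, hb12)` triple ★ p850178 `hOG_indicator_shell` consumes at `b := z·𝓘.aᵐ`.

## References
* [Rogawski1990] J. D. Rogawski, *Automorphic Representations of Unitary Groups in Three Variables*, Ann. of Math. Stud. 123 (1990): §1.10 p. 9; §12.7 Lemma 12.7.3 (proof) p. 195.
* [PlatonovRapinchuk1994] V. Platonov, A. Rapinchuk, *Algebraic Groups and Number Theory* (1994), §5.1 (the one-place model).
-/

set_option autoImplicit false
-- the mandated namespace has the single-problem summit's repeated segment (`HodgeConjecture.HodgeConjecture`)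
set_option linter.dupNamespace false

noncomputable section

open NumberField IsDedekindDomain
open scoped Matrix MatrixGroups WithZero
open Literature.NumberTheory Literature.NumberTheory.Automorphic Literature.NumberTheory.Automorphic.UnitaryGroup
open Literature.NumberTheory.GaloisRepresentations
open Literature.NumberTheory.Rogawski1990

namespace Summit.HodgeConjecture.HodgeConjecture.Cruxes.H413.F0P3cStCharTSBaseDiag

variable (L : Type) [Field L] [NumberField L] [IsCMField L] (v : HeightOneSpectrum (𝓞 ↥(maximalRealSubfield L)))
  (w : PlacesOver L v) (hw : IsCMField.complexConj L • w.1 = w.1)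

/-- **The `w`-component of the matrix of `z · aᵐ`**: `E₃ (z aᵐ) = d(βαᵐ, β, β(σ_w α)⁻ᵐ)` (as `(↑(z aᵐ) : Matrix).map ev_w`), for `E₃ z = β·1`, `E₃ a = d(α, 1, (σ_w α)⁻¹)`
(the pre-flip step of ★ `exists_flipBase`). [cite: Rogawski1990, §1.10 p. 9] [cite: PlatonovRapinchuk1994, §5.1] -/
theorem map_coe_central_mul_ray_pow
    {z a : ↥(unitaryGroupOfForm (conjLocal L (IsCMField.complexConj L) v) (cmLocalForm L 3 v))} {β α : w.1.adicCompletion L}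
    (hz : (((localNonsplitEquiv (IsCMField.complexConj L) (qsForm L) (IsCMField.complexConj_ne_one L) w hw z :
        ↥(unitaryGroupOfForm (galAdicCompletionMap (L := L) (IsCMField.complexConj L) hw) (placeForm (qsForm L) w.1))) :
        GL (Fin 3) (w.1.adicCompletion L)) : Matrix (Fin 3) (Fin 3) (w.1.adicCompletion L)) = β • (1 : Matrix (Fin 3) (Fin 3) (w.1.adicCompletion L)))
    (ha : (((localNonsplitEquiv (IsCMField.complexConj L) (qsForm L) (IsCMField.complexConj_ne_one L) w hw a :
        ↥(unitaryGroupOfForm (galAdicCompletionMap (L := L) (IsCMField.complexConj L) hw) (placeForm (qsForm L) w.1))) :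
        GL (Fin 3) (w.1.adicCompletion L)) : Matrix (Fin 3) (Fin 3) (w.1.adicCompletion L)) =
        Matrix.diagonal ![α, 1, ((galAdicCompletionMap (L := L) (IsCMField.complexConj L) hw) α)⁻¹]) (m : ℕ) :
    ((((z * a ^ m).val : GL (Fin 3) (LocalRing L v)) : Matrix (Fin 3) (Fin 3) (LocalRing L v)).map
        (Pi.evalRingHom (fun w' : PlacesOver L v => w'.1.adicCompletion L) w)) =
      Matrix.diagonal ![β * α ^ m, β, β * ((galAdicCompletionMap (L := L) (IsCMField.complexConj L) hw) α)⁻¹ ^ m] := by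
  have hz' : (((z.val : GL (Fin 3) (LocalRing L v)) : Matrix (Fin 3) (Fin 3) (LocalRing L v)).map
      (Pi.evalRingHom (fun w' : PlacesOver L v => w'.1.adicCompletion L) w)) = β • (1 : Matrix (Fin 3) (Fin 3) (w.1.adicCompletion L)) := hz
  have ha' : (((a.val : GL (Fin 3) (LocalRing L v)) : Matrix (Fin 3) (Fin 3) (LocalRing L v)).map
      (Pi.evalRingHom (fun w' : PlacesOver L v => w'.1.adicCompletion L) w)) =
      Matrix.diagonal ![α, 1, ((galAdicCompletionMap (L := L) (IsCMField.complexConj L) hw) α)⁻¹] := ha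
  rw [Subgroup.coe_mul, Subgroup.coe_pow, Units.val_mul, Units.val_pow_eq_pow_val, Matrix.map_mul, Matrix.map_pow, hz', ha',
    F0P3cStCharTSShellOrientation.diagonal_three_pow, smul_mul_assoc, one_mul, ← Matrix.diagonal_smul]
  congr 1
  funext i
  fin_cases i <;> simp

/-- **«B-DIAG★» — the unflipped base as a diagonal of units with INCREASING valuations at `w`.**  For `z` central in `U(Φ₃)(L⁺_v)` with `E₃ z = β·1`, `|β|_w = 1`, the ray `a`
with `E₃ a = d(α, 1, (σ_w α)⁻¹)`, `α ≠ 0`, `|α|_w < 1`, and `m ≥ 1` with `z aᵐ ∈ T₃`: there are units `db` of `∏_{w′} L_{w′}` with `glDiagonal 3 _ db = ↑(z aᵐ)`,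
`db 0 (w) = βαᵐ`, `db 1 (w) = β`, `db 2 (w) = β(σ_w α)⁻ᵐ`, hence `|db 0|_w < |db 1|_w` and `|db 1|_w < |db 2|_w` — the `hdb ∕ hb01 ∕ hb12` inputs of ★ p850178
`hOG_indicator_shell` at `b := z·𝓘.aᵐ` VERBATIM. [cite: Rogawski1990, §1.10 p. 9; §12.7 L. 12.7.3 (proof) p. 195] [cite: PlatonovRapinchuk1994, §5.1] -/
theorem exists_glDiagonal_central_mul_ray_pow
    {z a : ↥(unitaryGroupOfForm (conjLocal L (IsCMField.complexConj L) v) (cmLocalForm L 3 v))} {β α : w.1.adicCompletion L}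
    (hz : (((localNonsplitEquiv (IsCMField.complexConj L) (qsForm L) (IsCMField.complexConj_ne_one L) w hw z :
        ↥(unitaryGroupOfForm (galAdicCompletionMap (L := L) (IsCMField.complexConj L) hw) (placeForm (qsForm L) w.1))) :
        GL (Fin 3) (w.1.adicCompletion L)) : Matrix (Fin 3) (Fin 3) (w.1.adicCompletion L)) = β • (1 : Matrix (Fin 3) (Fin 3) (w.1.adicCompletion L)))
    (hβ : Valued.v β = 1)
    (ha : (((localNonsplitEquiv (IsCMField.complexConj L) (qsForm L) (IsCMField.complexConj_ne_one L) w hw a :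
        ↥(unitaryGroupOfForm (galAdicCompletionMap (L := L) (IsCMField.complexConj L) hw) (placeForm (qsForm L) w.1))) :
        GL (Fin 3) (w.1.adicCompletion L)) : Matrix (Fin 3) (Fin 3) (w.1.adicCompletion L)) =
        Matrix.diagonal ![α, 1, ((galAdicCompletionMap (L := L) (IsCMField.complexConj L) hw) α)⁻¹])
    (hα0 : α ≠ 0) (hα1 : Valued.v α < 1) {m : ℕ} (hm : 1 ≤ m) (hbM : z * a ^ m ∈ (cmBorelTriple L 3 v).M) :
    ∃ db : Fin 3 → (LocalRing L v)ˣ,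
      glDiagonal 3 (LocalRing L v) db = ((z * a ^ m : ↥(unitaryGroupOfForm (conjLocal L (IsCMField.complexConj L) v) (cmLocalForm L 3 v))) : GL (Fin 3) (LocalRing L v)) ∧
      ((db 0 : (LocalRing L v)ˣ) : LocalRing L v) w = β * α ^ m ∧ ((db 1 : (LocalRing L v)ˣ) : LocalRing L v) w = β ∧
      ((db 2 : (LocalRing L v)ˣ) : LocalRing L v) w = β * ((galAdicCompletionMap (L := L) (IsCMField.complexConj L) hw) α)⁻¹ ^ m ∧
      Valued.v ((((db 0 : (LocalRing L v)ˣ) : LocalRing L v) : LocalRing L v) w) < Valued.v ((((db 1 : (LocalRing L v)ˣ) : LocalRing L v) : LocalRing L v) w) ∧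
      Valued.v ((((db 1 : (LocalRing L v)ˣ) : LocalRing L v) : LocalRing L v) w) < Valued.v ((((db 2 : (LocalRing L v)ˣ) : LocalRing L v) : LocalRing L v) w) := by
  obtain ⟨db, hdb⟩ := (mem_torusU_iff _).1 hbM
  have hmap := map_coe_central_mul_ray_pow L v w hw hz ha m
  -- the diagonal entries at `w`
  have hent : ∀ i : Fin 3, ((db i : (LocalRing L v)ˣ) : LocalRing L v) w =
      Matrix.diagonal ![β * α ^ m, β, β * ((galAdicCompletionMap (L := L) (IsCMField.complexConj L) hw) α)⁻¹ ^ m] i i := by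
    intro i
    have h := congrFun (congrFun hmap i) i
    rw [Matrix.map_apply, ← hdb, coe_glDiagonal, Matrix.diagonal_apply_eq] at h
    exact h
  have h0 : ((db 0 : (LocalRing L v)ˣ) : LocalRing L v) w = β * α ^ m := by rw [hent 0]; rfl
  have h1 : ((db 1 : (LocalRing L v)ˣ) : LocalRing L v) w = β := by rw [hent 1]; rfl
  have h2 : ((db 2 : (LocalRing L v)ˣ) : LocalRing L v) w = β * ((galAdicCompletionMap (L := L) (IsCMField.complexConj L) hw) α)⁻¹ ^ m := by rw [hent 2]; rfl
  -- valuations: `|α|^m < 1 < |α|^{-m}`, `|σ_w α| = |α|`, `|β| = 1`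
  have hvα0 : Valued.v α ≠ 0 := (Valuation.ne_zero_iff _).2 hα0
  have hσv : Valued.v ((galAdicCompletionMap (L := L) (IsCMField.complexConj L) hw) α) = Valued.v α :=
    valued_galAdicCompletionMap (L := L) (IsCMField.complexConj L) hw α
  have hm0 : m ≠ 0 := Nat.one_le_iff_ne_zero.1 hm
  refine ⟨db, hdb, h0, h1, h2, ?_, ?_⟩
  · rw [h0, h1, map_mul, map_pow, hβ, one_mul]
    exact pow_lt_one₀ zero_le hα1 hm0
  · rw [h1, h2, map_mul, map_pow, map_inv₀, hσv, hβ, one_mul]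
    exact one_lt_pow₀ ((one_lt_inv₀ (zero_lt_iff.2 hvα0)).2 hα1) hm0

end Summit.HodgeConjecture.HodgeConjecture.Cruxes.H413.F0P3cStCharTSBaseDiag

end
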